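import Summits.QuantumFields.YangMills.Theorems.BalabanUVNodesN21ThresholdMixtureRStepLocalityRawRepaired

/-!
# N21 (NE7c), strategy s3 «alternative currency», file 34a (DEFINITIONS) — `normaliseWith`: r11's interior-local normalisation of a (2.12)
# solution map with the near-class representative a PARAMETER (same spec, same locality, and MEASURABLE when the representative is), plus the
# padding ∕ far-plaquette bookkeeping of a measurable representative

HEADER — WORK-UNIT METADATA.  Seat `pub-ymgap-dag-n21-e` (R141 (C) fan-out, node N21 = NE7c `T4IndicatorShell.ShellWeightBound`, strategy s3), g11,
file 34a (g10 HANDOFF trigger t32 «a measurable near-saturated selector `𝔟ᴺᴹ`», taken by own hand; split from 34b = `…N21NormaliseMeasurableDefs` by the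
400-line rule).  Lane: `--kind definition --supports stmt-QuantumFields-20509 --as helper` (K3⁶ `SpineGivenEndpointR13SepCoPR`).  Count-neutral.  The objects
are offered to NODE 00 (def-R ∕ K0c) for adoption; until re-homed they live here under this seat's namespace.

WHY.  Files 28–32 of this lineage read the record's `χ_k(Ω_k)` through r11's interior-local normalisation
`𝔟ᴺ K k := normalise (bgFamOfRecord F N ν K k) _` (`B14.Eq12InteriorLocality.normalise`): (LOC) is then a theorem (22c ∕ 28) and, since file 31, so is
(DISJ); but `normalise` picks the near-equivalent admissible datum `rep` by Hilbert's `ε` (r11 :398), about which NO measurability can be proved, so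
the (H-U) binder `Measurable (ukBox (𝔟ᴺ K k) M₁ □ k)` of file 32 stays displayed.  Meanwhile (H-U) is a THEOREM at the RAW family of record
(def-R FILE 19 v1.1 `localBgMeasurableBg_bgFam` ⟸ K0c `measurable_UminOfRecord`), which however has no interior locality under the global
class (file 26).  Files 34a ∕ 34b build the family with BOTH; this file is the representative-generic half.

THE CONTENT.
§1 `normaliseWith bg hreg r hr` — r11's `normalise` VERBATIM with the representative `r : DetSet P → MSField P G → MSField P G` a PARAMETER
   (spec `RepSpec bg r`: at every determining set of the standing range an admissible datum `X` is sent to an admissible datum agreeing with `X` on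
   `near 𝔹`).  Same class, same domain, a (2.12) solution map of the same spec (r11 `isMinimizer_spliceCfg`); on the `Γ₀`-bonds it IS the datum;
   for a CLASS-DETERMINED representative (`RepLocal r`) it is INTERIOR-LOCAL (r11's `normalise_local`, same proof); r11's map is the instance
   `r := rep bg` (`normalise_eq_normaliseWith`, `rfl`); (2.16) support-level dependence `ukBox_normaliseWith_congr_on`; and ★ `measurable_normaliseWith_U`:
   the solution map at `𝔹` is MEASURABLE as soon as `bg.U 𝔹` and `r 𝔹` are (the splice reads, bond by bond, a coordinate of `X₀` or of `bg.U 𝔹 (r 𝔹 X)`).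
§2 PADDING (any group): `pad0 𝔹 z q` ∕ `padNear 𝔹 X q` keep the datum on the near bonds (`bondsOf (nearSites 𝔹)` at scale `0`, `bondsOf (𝔹 j)` above), put
   `q` on the other scale-`0` bonds and `1` elsewhere — agreeing with `X` on `near 𝔹` (`agreeOn_near_padNear`) and CLASS-DETERMINED
   (`padNear_eq_of_agreeOn`); the FAR all-`Γ₀` plaquettes `farPlaqs 𝔹` (made of `Γ₀`-bonds, not inside the near bonds — where file 26's witnesses live)
   and `FarSmall δ 𝔹 z q` (the padded datum is `δ`-small there), with `farSmall_self_of_isMinimizer`: a SOLVABLE datum is far-small padded with itself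
   (on an all-`Γ₀` plaquette the datum is the minimiser, file 26 `plaqHol_eq_datum_of_isMinimizer`).  File 34b chooses `q` measurably.

HONEST FRAMING.  DEFINITIONS + [folklore] bookkeeping over r11 (`B14Eq12InteriorLocality`) and this lineage's file 26.  Nothing of Bałaban's is asserted
([15] Thm 1 NOT used); no record restated or re-pointed; NE7c NOT PRINTED ∕ NOT proved; N21 NOT discharged; counts UNMOVED (typed 28∕28 · discharged 5∕27);
count-neutral; one finite 𝕋⁴ at fixed `ε = L^{−K}` — NOT ℝ⁴ ∕ OS ∕ mass gap ∕ Clay.  No `sorry`, no `axiom`, no `instance`, no `notation`.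

CITATION HEADER (lean-in-tree rule 2026-08-18).  BY NAME: r11 `B14.Eq12InteriorLocality.normalise` ∕ `rep` ∕ `rep_spec` ∕ `spliceCfg` ∕ `spliceCfg_of_ext` ∕
`spliceCfg_of_not_ext` ∕ `isMinimizer_spliceCfg` ∕ `near` ∕ `nearSites` ∕ `near_succ` ∕ `near_range` ∕ `near_of_ext_not_far` ∕ `agreeOn_near_of_agreeOn` ∕ `farBonds` ∕
`extBonds` ∕ `plaqBonds` ∕ `plaqHol_congr` ∕ `Bj_standingRange` ∕ `PlaqDetermined`; r11 `B14.Eq216Concrete.ukBox` ∕ `ukBox_congr_on` ∕ `liftIter` ∕ `inputs`; r12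
`B15DeterminingSets.DetBackground` ∕ `IsMinimizer` ∕ `AgreeOn` ∕ `bondsOf`; `BIJ85Eq453GaugeField.qsstarGIter0`; file 26 `plaqHol_eq_datum_of_isMinimizer`.
Context only (SHAPE, nothing asserted): [Balaban1988Convergent] (1.2) p. 246, (2.2) p. 255, (2.10)–(2.13) p. 256, (2.16) p. 257.
-/

set_option autoImplicit false

noncomputable section

open MeasureTheory Set

namespace Summit.QuantumFields.YangMills.Theorems.N21NormaliseWithDefs

open Literature.MathematicalPhysics.QuantumFieldTheory.Balaban1983to89
open B15DeterminingSets B14.Eq213DetSet B14.Eq216Concrete B14.Eq12InteriorLocality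
open Literature.MathematicalPhysics.QuantumFieldTheory.BalabanImbrieJaffe1984to88.BIJ85Eq453GaugeField (qsstarGIter0)
open Summit.QuantumFields.YangMills.Theorems.N21ThresholdMixtureRStepLocalityRaw (plaqHol_eq_datum_of_isMinimizer)
/-! ## §1  `normaliseWith`: r11's normalisation with the near-class representative a parameter -/

section NormaliseWith

variable {P : Params} {G : Type*} [GaugeGroup G] {av : ∀ j, Averaging P j G}

/-- THE SPEC OF A NEAR-CLASS REPRESENTATIVE `r` for the datum `bg` (what r11's `rep_spec` gives Hilbert's `ε`): at every determining set of the
standing range, an admissible datum `X` is sent to an ADMISSIBLE datum agreeing with `X` on `near 𝔹`. [cite: Balaban1988Convergent, (2.12) p.256] -/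
def RepSpec (bg : DetBackground P G av) (r : DetSet P → MSField P G → MSField P G) : Prop :=
  ∀ 𝔹 : DetSet P, (∀ j, P.m + P.K < j → 𝔹 j = ∅) → ∀ X : MSField P G, X ∈ bg.dom 𝔹 →
    AgreeOn (near 𝔹) X (r 𝔹 X) ∧ r 𝔹 X ∈ bg.dom 𝔹

/-- A representative is CLASS-DETERMINED when it reads the datum only on `near 𝔹` (what r11's `rep_eq_of_agreeOn` gives Hilbert's `ε`).
[cite: Balaban1988Convergent, (2.10) p.256] -/
def RepLocal (r : DetSet P → MSField P G → MSField P G) : Prop :=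
  ∀ (𝔹 : DetSet P) (X X' : MSField P G), AgreeOn (near 𝔹) X X' → r 𝔹 X = r 𝔹 X'

variable (bg : DetBackground P G av) (hreg : PlaqDetermined bg.reg)
variable (r : DetSet P → MSField P G → MSField P G) (hr : RepSpec bg r)

open Classical in
/-- **THE NORMALISED SOLUTION MAP WITH A GIVEN REPRESENTATIVE** — r11's `normalise` with `rep bg ↦ r`: at a determining set of the standing range, the
splice of `bg`'s minimal configuration for the representative datum `r 𝔹 X` (inside) with the datum `X₀` (on the `Γ₀`-bonds); `bg` elsewhere.  SAME
class, SAME domain, a solution map of the same spec (r11 `isMinimizer_spliceCfg`). [cite: Balaban1988Convergent, (2.12) p.256] -/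
def normaliseWith : DetBackground P G av where
  reg := bg.reg
  dom := bg.dom
  U 𝔹 X := if (∀ j, P.m + P.K < j → 𝔹 j = ∅) then spliceCfg 𝔹 X (bg.U 𝔹 (r 𝔹 X)) else bg.U 𝔹 X
  isMinimizer 𝔹 X hX := by
    show IsMinimizer av bg.reg 𝔹 X
      (if (∀ j, P.m + P.K < j → 𝔹 j = ∅) then spliceCfg 𝔹 X (bg.U 𝔹 (r 𝔹 X)) else bg.U 𝔹 X)
    by_cases h𝔹 : ∀ j, P.m + P.K < j → 𝔹 j = ∅
    · rw [if_pos h𝔹]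
      exact isMinimizer_spliceCfg hreg h𝔹 (hr 𝔹 h𝔹 X hX).1 (bg.isMinimizer 𝔹 X hX)
        (bg.isMinimizer 𝔹 _ (hr 𝔹 h𝔹 X hX).2)
    · rw [if_neg h𝔹]
      exact bg.isMinimizer 𝔹 X hX

/-- Same regular class. [cite: Balaban1988Convergent, (2.12) p.256] -/
theorem normaliseWith_reg : (normaliseWith bg hreg r hr).reg = bg.reg := rfl

/-- Same domain of admissible data. [cite: Balaban1988Convergent, (2.12) p.256] -/
theorem normaliseWith_dom : (normaliseWith bg hreg r hr).dom = bg.dom := rfl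

open Classical in
/-- At a determining set of the standing range the map is the splice. [cite: Balaban1988Convergent, (2.12) p.256] -/
theorem normaliseWith_U {𝔹 : DetSet P} (h𝔹 : ∀ j, P.m + P.K < j → 𝔹 j = ∅) (X : MSField P G) :
    (normaliseWith bg hreg r hr).U 𝔹 X = spliceCfg 𝔹 X (bg.U 𝔹 (r 𝔹 X)) := by
  show (if (∀ j, P.m + P.K < j → 𝔹 j = ∅) then spliceCfg 𝔹 X (bg.U 𝔹 (r 𝔹 X)) else bg.U 𝔹 X) = _
  rw [if_pos h𝔹]

open Classical in
/-- Off the standing range the map is `bg`'s own. [cite: Balaban1988Convergent, (2.12) p.256 (bookkeeping)] -/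
theorem normaliseWith_U_of_not {𝔹 : DetSet P} (h𝔹 : ¬ ∀ j, P.m + P.K < j → 𝔹 j = ∅) (X : MSField P G) :
    (normaliseWith bg hreg r hr).U 𝔹 X = bg.U 𝔹 X := by
  show (if (∀ j, P.m + P.K < j → 𝔹 j = ∅) then spliceCfg 𝔹 X (bg.U 𝔹 (r 𝔹 X)) else bg.U 𝔹 X) = _
  rw [if_neg h𝔹]

/-- On the `Γ₀`-bonds the normalised configuration IS the datum, for every datum. [cite: Balaban1988Convergent, (2.11)–(2.12) p.256] -/
theorem normaliseWith_U_ext {𝔹 : DetSet P} (h𝔹 : ∀ j, P.m + P.K < j → 𝔹 j = ∅) (X : MSField P G) {b : PBond P 0}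
    (hb : b ∈ extBonds 𝔹) : (normaliseWith bg hreg r hr).U 𝔹 X b = X 0 b := by
  rw [normaliseWith_U bg hreg r hr h𝔹, spliceCfg_of_ext X _ hb]

/-- Inside, it is `bg`'s minimal configuration for the representative datum. [cite: Balaban1988Convergent, (2.12) p.256] -/
theorem normaliseWith_U_int {𝔹 : DetSet P} (h𝔹 : ∀ j, P.m + P.K < j → 𝔹 j = ∅) (X : MSField P G) {b : PBond P 0}
    (hb : b ∉ extBonds 𝔹) : (normaliseWith bg hreg r hr).U 𝔹 X b = bg.U 𝔹 (r 𝔹 X) b := by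
  rw [normaliseWith_U bg hreg r hr h𝔹, spliceCfg_of_not_ext X _ hb]

/-- The normalised configuration is a minimal configuration of the ORIGINAL problem for every admissible datum. [cite: Balaban1988Convergent, (2.12) p.256] -/
theorem isMinimizer_normaliseWith (𝔹 : DetSet P) {X : MSField P G} (hX : X ∈ bg.dom 𝔹) :
    IsMinimizer av bg.reg 𝔹 X ((normaliseWith bg hreg r hr).U 𝔹 X) :=
  (normaliseWith bg hreg r hr).isMinimizer 𝔹 X hX

/-- **INTERIOR LOCALITY** for a class-determined representative (r11's `normalise_local`, same proof): data agreeing on `near 𝔹` give the same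
configuration off the far `Γ₀`-bonds. [cite: Balaban1988Convergent, (1.2) p.246, (2.12) p.256] -/
theorem normaliseWith_local (hr' : RepLocal r) {𝔹 : DetSet P} (h𝔹 : ∀ j, P.m + P.K < j → 𝔹 j = ∅) {X X' : MSField P G}
    (h : AgreeOn (near 𝔹) X X') :
    ∀ b, b ∉ farBonds 𝔹 → (normaliseWith bg hreg r hr).U 𝔹 X b = (normaliseWith bg hreg r hr).U 𝔹 X' b := by
  intro b hb
  rw [normaliseWith_U bg hreg r hr h𝔹, normaliseWith_U bg hreg r hr h𝔹, hr' 𝔹 X X' h]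
  by_cases hbE : b ∈ extBonds 𝔹
  · rw [spliceCfg_of_ext X _ hbE, spliceCfg_of_ext X' _ hbE]
    exact h 0 b (near_of_ext_not_far hbE hb)
  · rw [spliceCfg_of_not_ext X _ hbE, spliceCfg_of_not_ext X' _ hbE]

/-- … a fortiori for data agreeing on all of `𝔹` (the (2.10) shape). [cite: Balaban1988Convergent, (2.10) p.256, (2.12) p.256] -/
theorem normaliseWith_local_of_agreeOn (hr' : RepLocal r) {𝔹 : DetSet P} (h𝔹 : ∀ j, P.m + P.K < j → 𝔹 j = ∅)
    {X X' : MSField P G} (h : AgreeOn 𝔹 X X') :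
    ∀ b, b ∉ farBonds 𝔹 → (normaliseWith bg hreg r hr).U 𝔹 X b = (normaliseWith bg hreg r hr).U 𝔹 X' b :=
  normaliseWith_local bg hreg r hr hr' h𝔹 (agreeOn_near_of_agreeOn h)

/-- r11's `normalise` IS the instance `r := rep bg` (Hilbert's `ε`). [cite: Balaban1988Convergent, (2.12) p.256 (bookkeeping)] -/
theorem normalise_eq_normaliseWith :
    normalise bg hreg = normaliseWith bg hreg (rep bg) (fun _ _ _ hX => rep_spec bg hX) := rfl

/-- **(2.16) AT SUPPORT LEVEL** for a class-determined representative: `U_{k,□}(V_k) = U_{k,□}(W_k)` off the far `Γ₀`-bonds of `𝐁_k(□^{∼4})` as soon as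
`V_k = W_k` on `liftIter k (inputs (near 𝐁_k(□^{∼4})))` (`k ≤ m + K`; r11 `ukBox_congr_on` with `hloc := normaliseWith_local`).
[cite: Balaban1988Convergent, (2.16) p.257] -/
theorem ukBox_normaliseWith_congr_on (hr' : RepLocal r) (M₁ : ℕ) {box4 : Set (Site P 0)} {k : ℕ} (hk : k ≤ P.m + P.K)
    {Vk Wk : GaugeField P k G} (h : ∀ c ∈ liftIter k (inputs (near (Bj M₁ box4 k))), Vk c = Wk c) :
    ∀ b₀ ∈ (farBonds (Bj M₁ box4 k))ᶜ,
      ukBox (normaliseWith bg hreg r hr) M₁ box4 k Vk b₀ = ukBox (normaliseWith bg hreg r hr) M₁ box4 k Wk b₀ :=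
  ukBox_congr_on (normaliseWith bg hreg r hr) M₁ (near (Bj M₁ box4 k)) (near_range (Bj_standingRange M₁ box4 hk))
    (farBonds (Bj M₁ box4 k))ᶜ
    (fun _ _ hX b₀ hb₀ => normaliseWith_local bg hreg r hr hr' (Bj_standingRange M₁ box4 hk) hX b₀ hb₀) h

/-- On the `Γ₀`-bonds of `𝐁_k(□^{∼4})`, `U_{k,□}(V)` IS the datum `Q_k^{s*}V`, for EVERY `V` (no solvability). [cite: Balaban1988Convergent, (2.2) p.255, (2.16) p.257] -/
theorem ukBox_normaliseWith_apply_of_mem_extBonds (M₁ : ℕ) {box4 : Set (Site P 0)} {k : ℕ} (hk : k ≤ P.m + P.K)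
    (V : GaugeField P k G) {b : PBond P 0} (hb : b ∈ extBonds (Bj M₁ box4 k)) :
    ukBox (normaliseWith bg hreg r hr) M₁ box4 k V b = qsstarGIter0 k V b :=
  normaliseWith_U_ext bg hreg r hr (Bj_standingRange M₁ box4 hk) _ hb

/-- ★ **MEASURABILITY OF THE NORMALISED SOLUTION MAP**: if `bg.U 𝔹` and the representative `r 𝔹` are measurable maps of the datum, so is
`(normaliseWith bg …).U 𝔹` (the splice reads, bond by bond, either the coordinate `X₀(b)` or a coordinate of `bg.U 𝔹 (r 𝔹 X)`). [folklore] -/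
theorem measurable_normaliseWith_U [MeasurableSpace G] (𝔹 : DetSet P) (hU : Measurable (bg.U 𝔹)) (hrm : Measurable (r 𝔹)) :
    Measurable ((normaliseWith bg hreg r hr).U 𝔹) := by
  by_cases h𝔹 : ∀ j, P.m + P.K < j → 𝔹 j = ∅
  · have heq : (normaliseWith bg hreg r hr).U 𝔹 = fun X => spliceCfg 𝔹 X (bg.U 𝔹 (r 𝔹 X)) :=
      funext fun X => normaliseWith_U bg hreg r hr h𝔹 X
    rw [heq]
    refine measurable_pi_lambda _ fun b => ?_
    by_cases hb : b ∈ extBonds 𝔹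
    · simp only [spliceCfg_of_ext _ _ hb]
      exact (measurable_pi_apply b).comp (measurable_pi_apply 0)
    · simp only [spliceCfg_of_not_ext _ _ hb]
      exact (measurable_pi_apply b).comp (hU.comp hrm)
  · have heq : (normaliseWith bg hreg r hr).U 𝔹 = bg.U 𝔹 :=
      funext fun X => normaliseWith_U_of_not bg hreg r hr h𝔹 X
    rw [heq]
    exact hU

end NormaliseWith

/-! ## §2  Padding a datum off its near bonds; the far all-`Γ₀` plaquettes -/

section Pad

variable {P : Params} {G : Type*}

open Classical in
/-- PADDING AT SCALE 0: `z` on the near `Γ₀`-bonds `bondsOf (nearSites 𝔹)`, `q` on every other scale-`0` bond. [cite: Balaban1988Convergent, (2.2) p.255] -/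
def pad0 (𝔹 : DetSet P) (z q : GaugeField P 0 G) : GaugeField P 0 G :=
  fun b => if b ∈ bondsOf (nearSites 𝔹) then z b else q b

open Classical in
/-- `pad0` on a near bond. [cite: Balaban1988Convergent, (2.2) p.255 (bookkeeping)] -/
theorem pad0_of_mem (𝔹 : DetSet P) (z q : GaugeField P 0 G) {b : PBond P 0} (hb : b ∈ bondsOf (nearSites 𝔹)) :
    pad0 𝔹 z q b = z b := by
  show (if b ∈ bondsOf (nearSites 𝔹) then z b else q b) = z b
  rw [if_pos hb]

open Classical in
/-- `pad0` off the near bonds. [cite: Balaban1988Convergent, (2.2) p.255 (bookkeeping)] -/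
theorem pad0_of_not_mem (𝔹 : DetSet P) (z q : GaugeField P 0 G) {b : PBond P 0} (hb : b ∉ bondsOf (nearSites 𝔹)) :
    pad0 𝔹 z q b = q b := by
  show (if b ∈ bondsOf (nearSites 𝔹) then z b else q b) = q b
  rw [if_neg hb]

/-- `pad0` reads `z` only on the near bonds. [cite: Balaban1988Convergent, (2.10) p.256 (bookkeeping)] -/
theorem pad0_congr (𝔹 : DetSet P) {z z' : GaugeField P 0 G} (h : ∀ b ∈ bondsOf (nearSites 𝔹), z b = z' b) (q : GaugeField P 0 G) :
    pad0 𝔹 z q = pad0 𝔹 z' q := by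
  funext b
  by_cases hb : b ∈ bondsOf (nearSites 𝔹)
  · rw [pad0_of_mem 𝔹 z q hb, pad0_of_mem 𝔹 z' q hb, h b hb]
  · rw [pad0_of_not_mem 𝔹 z q hb, pad0_of_not_mem 𝔹 z' q hb]

/-- Padding a padded configuration forgets the first filler. [cite: Balaban1988Convergent, (2.10) p.256 (bookkeeping)] -/
theorem pad0_pad0 (𝔹 : DetSet P) (z q q' : GaugeField P 0 G) : pad0 𝔹 (pad0 𝔹 z q') q = pad0 𝔹 z q :=
  pad0_congr 𝔹 (fun _ hb => pad0_of_mem 𝔹 z q' hb) q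

/-- Padding with itself is the identity. [cite: Balaban1988Convergent, (2.10) p.256 (bookkeeping)] -/
theorem pad0_self (𝔹 : DetSet P) (z : GaugeField P 0 G) : pad0 𝔹 z z = z := by
  funext b
  by_cases hb : b ∈ bondsOf (nearSites 𝔹)
  · rw [pad0_of_mem 𝔹 z z hb]
  · rw [pad0_of_not_mem 𝔹 z z hb]

variable [One G]

open Classical in
/-- PADDING OF A MULTI-SCALE DATUM: `X` on the near bonds (`nearSites 𝔹` at scale `0`, `𝔹 j` above), `q` on the other scale-`0` bonds, `1` on the other
higher bonds. [cite: Balaban1988Convergent, (2.2) p.255, (2.10) p.256] -/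
def padNear (𝔹 : DetSet P) (X : MSField P G) (q : GaugeField P 0 G) : MSField P G
  | 0 => pad0 𝔹 (X 0) q
  | j + 1 => fun b => if b ∈ bondsOf (𝔹 (j + 1)) then X (j + 1) b else 1

/-- Scale `0` of the padded datum. [cite: Balaban1988Convergent, (2.2) p.255 (bookkeeping)] -/
theorem padNear_zero (𝔹 : DetSet P) (X : MSField P G) (q : GaugeField P 0 G) : padNear 𝔹 X q 0 = pad0 𝔹 (X 0) q := rfl

open Classical in
/-- Higher scales of the padded datum. [cite: Balaban1988Convergent, (2.10) p.256 (bookkeeping)] -/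
theorem padNear_succ (𝔹 : DetSet P) (X : MSField P G) (q : GaugeField P 0 G) (j : ℕ) :
    padNear 𝔹 X q (j + 1) = fun b => if b ∈ bondsOf (𝔹 (j + 1)) then X (j + 1) b else 1 := rfl

open Classical in
/-- The padded datum agrees with the datum on `near 𝔹`. [cite: Balaban1988Convergent, (2.10) p.256] -/
theorem agreeOn_near_padNear (𝔹 : DetSet P) (X : MSField P G) (q : GaugeField P 0 G) : AgreeOn (near 𝔹) X (padNear 𝔹 X q) := by
  intro j b hb
  cases j with
  | zero => exact (pad0_of_mem 𝔹 (X 0) q hb).symm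
  | succ j =>
    rw [near_succ] at hb
    show X (j + 1) b = (if b ∈ bondsOf (𝔹 (j + 1)) then X (j + 1) b else 1)
    rw [if_pos hb]

open Classical in
/-- The padded datum reads the datum only on `near 𝔹` (class-determined). [cite: Balaban1988Convergent, (2.10) p.256] -/
theorem padNear_eq_of_agreeOn (𝔹 : DetSet P) {X X' : MSField P G} (h : AgreeOn (near 𝔹) X X') (q : GaugeField P 0 G) :
    padNear 𝔹 X q = padNear 𝔹 X' q := by
  funext j
  cases j with
  | zero => exact pad0_congr 𝔹 (fun b hb => h 0 b hb) q
  | succ j =>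
    funext b
    by_cases hb : b ∈ bondsOf (𝔹 (j + 1))
    · show (if b ∈ bondsOf (𝔹 (j + 1)) then X (j + 1) b else 1) = (if b ∈ bondsOf (𝔹 (j + 1)) then X' (j + 1) b else 1)
      rw [if_pos hb, if_pos hb]
      exact h (j + 1) b hb
    · show (if b ∈ bondsOf (𝔹 (j + 1)) then X (j + 1) b else 1) = (if b ∈ bondsOf (𝔹 (j + 1)) then X' (j + 1) b else 1)
      rw [if_neg hb, if_neg hb]

end Pad

section Far

variable {P : Params} {G : Type*} [GaugeGroup G]

/-- THE FAR ALL-`Γ₀` PLAQUETTES of a determining set: made of `Γ₀`-bonds, NOT inside the near bonds — the plaquettes on which the (2.12) class constrains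
the datum itself away from the support (file 26's witnesses live here). [cite: Balaban1988Convergent, (2.2) p.255, (2.12) p.256] -/
def farPlaqs (𝔹 : DetSet P) : Set (Plaq P 0) :=
  {p | plaqBonds p ⊆ extBonds 𝔹 ∧ ¬ plaqBonds p ⊆ bondsOf (nearSites 𝔹)}

/-- FAR SMALLNESS: the padded scale-`0` datum `pad0 𝔹 z q` is `δ`-small on every far all-`Γ₀` plaquette. [cite: Balaban1988Convergent, (2.12) p.256] -/
def FarSmall (δ : ℝ) (𝔹 : DetSet P) (z q : GaugeField P 0 G) : Prop :=
  ∀ p ∈ farPlaqs 𝔹, GaugeGroup.dist1 (GaugeField.plaqHol (pad0 𝔹 z q) p) < δ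

/-- On a plaquette inside the near bonds the padded datum has `z`'s plaquette variable. [cite: Balaban1988Convergent, (2.2) p.255 (bookkeeping)] -/
theorem plaqHol_pad0_of_near (𝔹 : DetSet P) (z q : GaugeField P 0 G) {p : Plaq P 0} (hp : plaqBonds p ⊆ bondsOf (nearSites 𝔹)) :
    GaugeField.plaqHol (pad0 𝔹 z q) p = GaugeField.plaqHol z p :=
  plaqHol_congr fun _ hb => pad0_of_mem 𝔹 z q (hp hb)

/-- Far smallness reads `z` only on the near bonds. [cite: Balaban1988Convergent, (2.10) p.256 (bookkeeping)] -/
theorem farSmall_pad0_iff (δ : ℝ) (𝔹 : DetSet P) (z q q' : GaugeField P 0 G) : FarSmall δ 𝔹 (pad0 𝔹 z q') q ↔ FarSmall δ 𝔹 z q := by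
  unfold FarSmall
  rw [pad0_pad0]

/-- A scale-`0` datum that is `δ`-small on every all-`Γ₀` plaquette is far-small padded with ITSELF — the case of a SOLVABLE datum (on an all-`Γ₀` plaquette
the datum is the minimiser, file 26). [cite: Balaban1988Convergent, (2.12) p.256] -/
theorem farSmall_self_of_isMinimizer {av : ∀ j, Averaging P j G} {δ : ℝ} {𝔹 : DetSet P} {X : MSField P G} {W : GaugeField P 0 G}
    (hW : IsMinimizer av {U | PlaqSmall δ U} 𝔹 X W) : FarSmall δ 𝔹 (X 0) (X 0) := by
  intro p hp
  rw [pad0_self, ← plaqHol_eq_datum_of_isMinimizer hW hp.1]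
  exact hW.1 p

end Far

end Summit.QuantumFields.YangMills.Theorems.N21NormaliseWithDefs

end
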